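import Mathlib.MeasureTheory.Group.Prod
import Mathlib.MeasureTheory.Constructions.Pi
import Mathlib.MeasureTheory.Measure.Haar.InnerProductSpace
import Mathlib.MeasureTheory.Measure.Lebesgue.EqHaar
import Mathlib.MeasureTheory.Integral.Marginal
import Mathlib.MeasureTheory.Constructions.Polish.Basic
import Mathlib.Analysis.Fourier.AddCircleMulti
import Mathlib.Analysis.InnerProductSpace.Projection.Submodule
import Mathlib.Algebra.QuadraticDiscriminant
import Literature.Analysis.FluidPDE.HardSphereFlowConstruction
import Literature.Analysis.FluidPDE.HardSphereRegularGeometry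
import Literature.Analysis.FluidPDE.HardSphereBilliard
import HarnessLib

/-!
# The torus phase space as a measure space: energy shells, charts, Fubini, null and thin sets

Fourth layer of the proof of Alexander's theorem on `T^d`
(`Kinetic.HardSphereFlow.nonempty_torus`, reduced in
`Literature.Analysis.FluidPDE.HardSphereFlowConstruction` to five named facts, of which the
deterministic ones and measurability are discharged in `HardSphereFlowOrbits`,
`HardSphereFlowGroup`, `HardSphereFlowMeasurable`). This file is the measure-theoretic toolkit
for the two remaining facts, `torusFlow_ae_good` (Alexander's theorem proper: pathological data
are Liouville-null) and `torusFlow_measurePreserving` (Liouville's theorem for the hard-sphere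
flow), following Gallagher–Saint-Raymond–Texier 2013, proof of Prop. 4.1.1 and Lemma 4.1.2:

* energy is conserved along the collision-by-collision flow (`Alexander.configEnergy_flow`), so
  speeds stay bounded on an energy shell (`norm_vel_le_of_configEnergy_le`), and the shell lies in
  the velocity ball `velBall` (`setOf_configEnergy_le_subset_velBall`);
* the minimal image on the torus: `reprSym` is a shortest lift, the minimal-image distance is
  `1`-Lipschitz under translations (`Torus.euclidDist_translate_le`), and is *additive in the
  chart* `‖·‖ < 1/2` (`Torus.reprSym_add_proj_of_norm_lt`, `Torus.sepVec_translate_of_norm_lt`);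
* the velocity flip preserves `volume` on `(X × ℝ^d)^N` for any measure space `X`
  (`Kinetic.measurePreserving_flipVel`). Liouville's theorem for the *free flight* on
  `(T^d × ℝ^d)^N` — the named fact `Kinetic.measurePreserving_freeFlight_torus` of
  `HardSpherePhaseSpace` — is **not** re-proved here: it is already discharged in the tree by
  `Barriers.AtomisticToContinuum.measurePreserving_freeFlight_torus_holds`
  (`Literature.Barriers.AtomisticToContinuum.BoltzmannHypothesis`), and is the case
  `G = Torus.geometry d` of `Kinetic.measurePreserving_freeFlight_of_translate`
  (`HardSpherePhaseSpaceProofs`);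
* `reprSym` pushes Haar measure to Lebesgue measure on the cube `(-1/2, 1/2]^d`
  (`Torus.map_reprSym_volume`), whence the Haar measure of minimal-image balls, spheres (null) and
  annuli (`≤ d η vol B₁`, `Torus.volume_annulus_le`), and `proj` pushes Lebesgue measure on the
  cube to Haar measure (`Torus.map_proj_volume_restrict_symCube`);
* Fubini one particle at a time on `(T^d × ℝ^d)^N` with velocity cut-off
  (`pi_oneParticleMeasure`, `volume_inter_velBall_le_of_sections`, `volume_eq_zero_of_sections`,
  via Mathlib's `lmarginal`);
* consequences: contact sets are null (`volume_contactSet`); **two thin shells cost `r²`**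
  (`volume_closePair_inter_closePair_le`, GST 2013 Lemma 4.1.2); grazing configurations
  (vanishing discriminant `pairDisc` of `HardSphereBilliard`) are null
  (`volume_setOf_pairDisc_sepVec_eq_zero`), via a line-section null criterion on `ℝ^d`
  (`volume_eq_zero_of_line_sections`) and the fact that a genuine quadratic has a null zero set.

## Mathlib / Literature reuse

`MeasureTheory.lmarginal` and `lintegral_le_of_lmarginal_le`, `Measure.restrict_pi_pi`,
`Measure.prod_restrict`, `Measure.prod_apply_symm`, `MeasurePreserving.skew_product`,
`measurePreserving_pi`, `AddCircle.measurePreserving_equivIoc`, `PiLp.volume_preserving_toLp`,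
`Measure.addHaar_ball/closedBall/sphere`, `measure_preimage_add_right`,
`lintegral_lintegral_swap`, `quadratic_eq_zero_iff`, `Submodule.orthogonal_eq_bot_iff` are
Mathlib's. `Torus.reprSym`/`Torus.proj`/`Kinetic.liouville` are `HardSpherePhaseSpace`'s and
`FlatTorus`', the chart additivity `Torus.reprSym_add_proj` is `HardSphereRegularGeometry`'s,
`Kinetic.pairDisc` is `HardSphereBilliard`'s. Nothing here is specific to hard spheres beyond
the sets being measured.

## Notes for the librarian

`Torus.symCube = (-1/2, 1/2]^d` with `Torus.map_reprSym_volume` / `Torus.measurePreserving_reprSym`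
and `Torus.closedBall_subset_symCube` are the `reprSym`-versions (the section
`AddCircle.equivIoc 1 (-1/2)` used by `HardSpherePhaseSpace`) of two developments already in
the tree: `Torus.unitCube = [0, 1)^d` with `Torus.measurePreserving_repr`
(`Analysis/FunctionSpaces/FlatTorusProofs.lean`) and `Torus.centredCube = [-1/2, 1/2)^d` with
`Torus.reprc`, `Torus.measurePreserving_reprc`, `Torus.ball_half_subset_centredCube`
(`Analysis/FunctionSpaces/TorusMollifier.lean`, whose header already flags `reprSym` vs `reprc`).
The three sections differ only on the faces of the cube (a null set); they are to be merged.

## Design choices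

* All measure statements are for `volume` on `Config N d (UnitAddTorus d)`
  (`= Measure.pi`, each factor `volume.prod volume` on `T^d × ℝ^d`), the measure underlying
  `Kinetic.liouville`.
* Quantitative Fubini is phrased with the finite one-particle measure `oneParticleMeasure d V`
  (Haar × Lebesgue on `B̄(0, V)`), whose `N`-fold product is `volume` restricted to the velocity
  ball; this avoids dividing by masses.
* The grazing set is described algebraically by the discriminant of `HardSphereBilliard`, so that
  the short-time analysis can quote `billiardGood` verbatim.

## References

* I. Gallagher, L. Saint-Raymond, B. Texier, *From Newton to Boltzmann: hard spheres and
  short-range potentials*, EMS (2013), arXiv:1208.5753, §4.1, Prop. 4.1.1, Lemma 4.1.2 (p. 19).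
* C. Cercignani, R. Illner, M. Pulvirenti, *The Mathematical Theory of Dilute Gases*, Springer
  (1994), §4.2, App. 4.A.
-/

open Set Filter Topology Function MeasureTheory Metric
open scoped ENNReal InnerProductSpace

namespace Literature.Analysis.FluidPDE

noncomputable section

section Kinetic

variable {d : Type*} [Fintype d] {X : Type*} {N : ℕ}

/-! ## Energy along the collision-by-collision flow -/

namespace Alexander

variable {G : Geometry d X} {ε : ℝ}

/-- The collision step conserves the kinetic energy. [folklore] -/
theorem configEnergy_collisionStep (z : Config N d X) :
    configEnergy (collisionStep G ε z) = configEnergy z := by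
  by_cases h1 : freeExitTime G ε z = ∞
  · rw [collisionStep_of_eq_top h1]
  · rw [collisionStep, if_neg h1]
    dsimp only
    by_cases h2 : (incomingPairs G ε (freeFlight G (freeExitTime G ε z).toReal z)).Nonempty
    · rw [dif_pos h2, configEnergy_collidePair (ne_of_lt (mem_incomingPairs.1 h2.some_mem).1),
        configEnergy_freeFlight]
    · rw [dif_neg h2, configEnergy_freeFlight]

/-- The post-collisional states have the kinetic energy of the datum. [folklore] -/
theorem configEnergy_stateAfter (z : Config N d X) (k : ℕ) :
    configEnergy (stateAfter G ε z k) = configEnergy z := by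
  induction k with
  | zero => rfl
  | succ k ih => rw [stateAfter_succ, configEnergy_collisionStep, ih]

/-- The forward flow conserves the kinetic energy (for every datum). [folklore] -/
theorem configEnergy_fwdFlow (z : Config N d X) (t : ℝ) :
    configEnergy (fwdFlow G ε z t) = configEnergy z := by
  rw [fwdFlow, configEnergy_freeFlight, configEnergy_stateAfter]

/-- The left-continuous forward flow conserves the kinetic energy. [folklore] -/
theorem configEnergy_fwdFlowLeft (z : Config N d X) (t : ℝ) :
    configEnergy (fwdFlowLeft G ε z t) = configEnergy z := by
  rw [fwdFlowLeft, configEnergy_freeFlight, configEnergy_stateAfter]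

/-- **Conservation of energy** for the collision-by-collision flow: `E(T^t z) = E(z)` for every
datum (GST 2013 §1.1; CIP 1994 §4.2). [cite: GST2013, §1.1] -/
theorem configEnergy_flow (t : ℝ) (z : Config N d X) :
    configEnergy (flow G ε t z) = configEnergy z := by
  unfold flow
  split_ifs
  · exact configEnergy_fwdFlow z t
  · rw [configEnergy_flipVel, configEnergy_fwdFlowLeft, configEnergy_flipVel]

end Alexander

/-- Each speed is controlled by the kinetic energy: `‖v_i‖² ≤ 2 E(z)`. [folklore] -/
theorem norm_vel_sq_le_two_mul_configEnergy (z : Config N d X) (i : Fin N) :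
    ‖(z i).2‖ ^ 2 ≤ 2 * configEnergy z := by
  unfold configEnergy
  have h : ‖(z i).2‖ ^ 2 ≤ ∑ j, ‖(z j).2‖ ^ 2 :=
    Finset.single_le_sum (f := fun j => ‖(z j).2‖ ^ 2) (fun j _ => sq_nonneg _) (Finset.mem_univ i)
  linarith

/-- On the energy shell `E(z) ≤ V²/2` every speed is at most `V`. [folklore] -/
theorem norm_vel_le_of_configEnergy_le {V : ℝ} (hV : 0 ≤ V) {z : Config N d X}
    (hz : configEnergy z ≤ V ^ 2 / 2) (i : Fin N) : ‖(z i).2‖ ≤ V := by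
  have h := norm_vel_sq_le_two_mul_configEnergy z i
  exact (pow_le_pow_iff_left₀ (norm_nonneg _) hV two_ne_zero).1 (by nlinarith)

end Kinetic

/-! ## The minimal image on the torus: charts and displacements -/

namespace Torus

variable {d : Type*}

/-- The symmetric representative is a shortest lift, coordinatewise: `|reprSym x i| ≤ |a i|`
for every lift `a` of `x`. [folklore] -/
theorem abs_reprSym_apply_le_of_proj_eq {a : EuclideanSpace ℝ d} {x : UnitAddTorus d}
    (h : FunctionSpaces.Torus.proj a = x) (i : d) : |reprSym x i| ≤ |a i| := by
  rw [abs_reprSym_apply, ← h, FunctionSpaces.Torus.proj_apply, UnitAddCircle.norm_eq]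
  simpa using round_le (a i) 0

variable [Fintype d]

/-- The symmetric representative is a shortest lift: `‖reprSym x‖ ≤ ‖a‖` for every lift `a`
of `x` (the minimal image realises the quotient distance). This is
`Torus.euclidDist_proj_le_norm_sub_holds a 0` of `HardSpherePhaseSpaceProofs` in another guise;
it is kept here (five lines) so that this file does not depend on that module. [folklore] -/
theorem norm_reprSym_le_of_proj_eq {a : EuclideanSpace ℝ d} {x : UnitAddTorus d}
    (h : FunctionSpaces.Torus.proj a = x) : ‖reprSym x‖ ≤ ‖a‖ := by
  rw [EuclideanSpace.norm_eq, EuclideanSpace.norm_eq]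
  refine Real.sqrt_le_sqrt (Finset.sum_le_sum fun i _ => ?_)
  rw [Real.norm_eq_abs, Real.norm_eq_abs]
  exact pow_le_pow_left₀ (abs_nonneg _) (abs_reprSym_apply_le_of_proj_eq h i) 2

/-- **The minimal-image distance is `1`-Lipschitz under translations**:
`‖reprSym (x + proj a)‖ ≤ ‖reprSym x‖ + ‖a‖`. [folklore] -/
theorem norm_reprSym_add_proj_le (x : UnitAddTorus d) (a : EuclideanSpace ℝ d) :
    ‖reprSym (x + FunctionSpaces.Torus.proj a)‖ ≤ ‖reprSym x‖ + ‖a‖ := by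
  refine (norm_reprSym_le_of_proj_eq (a := reprSym x + a) ?_).trans (norm_add_le _ _)
  rw [FunctionSpaces.Torus.proj_add, proj_reprSym]

/-- The minimal-image distance of two translated points changes by at most the sum of the
displacements. [folklore] -/
theorem euclidDist_translate_le (x y : UnitAddTorus d) (a b : EuclideanSpace ℝ d) :
    euclidDist (x + FunctionSpaces.Torus.proj a) (y + FunctionSpaces.Torus.proj b) ≤ euclidDist x y + ‖a - b‖ := by
  unfold euclidDist
  have h : x + FunctionSpaces.Torus.proj a - (y + FunctionSpaces.Torus.proj b) = (x - y) + FunctionSpaces.Torus.proj (a - b) := by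
    rw [sub_eq_add_neg a b, FunctionSpaces.Torus.proj_add, FunctionSpaces.Torus.proj_neg]
    abel
  rw [h]
  exact norm_reprSym_add_proj_le _ _

/-- And conversely (translate back). [folklore] -/
theorem euclidDist_le_euclidDist_translate (x y : UnitAddTorus d) (a b : EuclideanSpace ℝ d) :
    euclidDist x y ≤ euclidDist (x + FunctionSpaces.Torus.proj a) (y + FunctionSpaces.Torus.proj b) + ‖a - b‖ := by
  have h := euclidDist_translate_le (x + FunctionSpaces.Torus.proj a) (y + FunctionSpaces.Torus.proj b) (-a) (-b)
  simp only [FunctionSpaces.Torus.proj_neg, add_neg_cancel_right] at h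
  rwa [show -a - -b = -(a - b) by abel, norm_neg] at h

/-- **The chart of the minimal image**: if `‖reprSym x‖ + ‖s‖ < 1/2` then
`reprSym (x + proj s) = reprSym x + s` (the minimal image is additive as long as one stays in
the open cube). [folklore] -/
theorem reprSym_add_proj_of_norm_lt {x : UnitAddTorus d} {s : EuclideanSpace ℝ d}
    (h : ‖reprSym x‖ + ‖s‖ < 1 / 2) : reprSym (x + FunctionSpaces.Torus.proj s) = reprSym x + s := by
  refine reprSym_add_proj fun i => ?_
  have h1 : |reprSym x i| ≤ ‖reprSym x‖ := abs_reprSym_apply_le_norm x i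
  have h2 : |s i| ≤ ‖s‖ := by simpa using PiLp.norm_apply_le s i
  rw [abs_le] at h1 h2
  constructor <;> linarith [h1.1, h1.2, h2.1, h2.2]

/-- The separation vector of the torus geometry along free flight, quantitatively: if
`‖x_i - x_j‖ + |t| ‖v_i - v_j‖ < 1/2` (minimal image) then
`sep(x_i + t v_i, x_j + t v_j) = sep(x_i, x_j) + t (v_i - v_j)`. [folklore] -/
theorem sepVec_translate_of_norm_lt {x y : UnitAddTorus d} {a b : EuclideanSpace ℝ d}
    (h : ‖(geometry d).sepVec x y‖ + ‖a - b‖ < 1 / 2) :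
    (geometry d).sepVec ((geometry d).translate x a) ((geometry d).translate y b) =
      (geometry d).sepVec x y + (a - b) := by
  simp only [geometry_sepVec, geometry_translate] at h ⊢
  have hxy : x + FunctionSpaces.Torus.proj a - (y + FunctionSpaces.Torus.proj b) = (x - y) + FunctionSpaces.Torus.proj (a - b) := by
    rw [sub_eq_add_neg a b, FunctionSpaces.Torus.proj_add, FunctionSpaces.Torus.proj_neg]
    abel
  rw [hxy]
  exact reprSym_add_proj_of_norm_lt h

end Torus

/-! ## The velocity flip preserves volume -/

section Kinetic

variable {d : Type*} [Fintype d] {X : Type*} [MeasureSpace X] {N : ℕ}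

/-- The velocity flip `(x_i, v_i)_i ↦ (x_i, -v_i)_i` preserves `volume` on `(X × ℝ^d)^N`, for
every measure space `X` with σ-finite `volume` (negation preserves Lebesgue measure on `ℝ^d`,
`Measure.measurePreserving_neg`; then product and finite power, `volume_preserving_pi`).
[folklore] -/
theorem measurePreserving_flipVel [SigmaFinite (volume : Measure X)] :
    MeasurePreserving (flipVel : Config N d X → Config N d X) volume volume := by
  have h1 : MeasurePreserving (fun p : X × EuclideanSpace ℝ d => (p.1, -p.2)) volume volume :=
    (MeasurePreserving.id volume).prod (Measure.measurePreserving_neg volume)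
  exact volume_preserving_pi fun _ : Fin N => h1

end Kinetic

/-! ## `reprSym` and Haar measure: minimal-image balls, spheres and annuli -/

namespace Torus

variable {d : Type*} [Fintype d]

/-- The half-open symmetric unit cube `(-1/2, 1/2]^d ⊂ ℝ^d`, the range of `reprSym`. [folklore] -/
def symCube (d : Type*) [Fintype d] : Set (EuclideanSpace ℝ d) :=
  {y | ∀ i, y i ∈ Ioc (-(1 / 2 : ℝ)) (1 / 2)}

/-- The symmetric cube is measurable. [folklore] -/
theorem measurableSet_symCube : MeasurableSet (symCube d) := by
  have : symCube d = ⋂ i, (fun y : EuclideanSpace ℝ d => y i) ⁻¹' Ioc (-(1 / 2 : ℝ)) (1 / 2) := by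
    ext y; simp [symCube]
  rw [this]
  exact MeasurableSet.iInter fun i => measurableSet_Ioc.preimage (by fun_prop)

/-- `reprSym` takes values in the symmetric cube. [folklore] -/
theorem reprSym_mem_symCube (x : UnitAddTorus d) : reprSym x ∈ symCube d :=
  fun i => reprSym_apply_mem_Ioc x i

/-- One coordinate: the symmetric representative `AddCircle.equivIoc 1 (-1/2)` pushes the Haar
probability measure of `UnitAddCircle` to Lebesgue measure on `(-1/2, 1/2]`. [folklore] -/
theorem map_equivIoc_volume (a : ℝ) :
    Measure.map (fun c : UnitAddCircle => ((AddCircle.equivIoc 1 a c : ℝ))) volume =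
      volume.restrict (Ioc a (a + 1)) := by
  have h1 : (fun c : UnitAddCircle => ((AddCircle.equivIoc 1 a c : ℝ))) =
      Subtype.val ∘ AddCircle.measurableEquivIoc 1 a := rfl
  rw [h1, ← Measure.map_map measurable_subtype_coe (AddCircle.measurableEquivIoc 1 a).measurable]
  have h2 := (AddCircle.measurePreserving_equivIoc 1 (a := a)).map_eq
  change Measure.map (AddCircle.measurableEquivIoc 1 a) volume = _ at h2
  rw [h2, map_comap_subtype_coe measurableSet_Ioc]

/-- **`reprSym` pushes the Haar probability measure of `T^d` to Lebesgue measure on the cube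
`(-1/2, 1/2]^d`.** [folklore] -/
theorem map_reprSym_volume :
    Measure.map (reprSym : UnitAddTorus d → EuclideanSpace ℝ d) volume =
      volume.restrict (symCube d) := by
  have hmeas : Measurable fun c : UnitAddCircle => ((AddCircle.equivIoc 1 (-(1 / 2 : ℝ)) c : ℝ)) :=
    measurable_subtype_coe.comp (AddCircle.measurableEquivIoc 1 (-(1 / 2 : ℝ))).measurable
  have hpi : MeasurePreserving (fun (x : UnitAddTorus d) (i : d) =>
      ((AddCircle.equivIoc 1 (-(1 / 2 : ℝ)) (x i) : ℝ))) (volume : Measure (UnitAddTorus d))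
      (Measure.pi fun _ : d => (volume : Measure ℝ).restrict (Ioc (-(1 / 2 : ℝ)) (-(1 / 2) + 1))) :=
    measurePreserving_pi (fun _ : d => (volume : Measure UnitAddCircle))
      (fun _ : d => (volume : Measure ℝ).restrict (Ioc (-(1 / 2 : ℝ)) (-(1 / 2) + 1)))
      (f := fun (_ : d) (c : UnitAddCircle) => ((AddCircle.equivIoc 1 (-(1 / 2 : ℝ)) c : ℝ)))
      fun _ => ⟨hmeas, map_equivIoc_volume _⟩
  rw [← Measure.restrict_pi_pi] at hpi
  have hL := PiLp.volume_preserving_toLp d  -- MeasurePreserving (toLp 2) volume volume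
  have hcomp : (reprSym : UnitAddTorus d → EuclideanSpace ℝ d) =
      (WithLp.toLp 2) ∘ fun (x : UnitAddTorus d) (i : d) =>
        ((AddCircle.equivIoc 1 (-(1 / 2 : ℝ)) (x i) : ℝ)) := rfl
  have hset : symCube d = (WithLp.toLp 2) '' (Set.univ.pi fun _ : d => Ioc (-(1 / 2 : ℝ)) (-(1 / 2) + 1)) := by
    ext y
    simp only [symCube, mem_setOf_eq, mem_image, mem_univ_pi]
    constructor
    · intro h
      exact ⟨WithLp.ofLp y, fun i => by norm_num; exact h i, rfl⟩
    · rintro ⟨z, hz, rfl⟩ i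
      have := hz i
      norm_num at this
      exact this
  rw [hcomp, ← Measure.map_map (WithLp.measurable_toLp 2 _) hpi.measurable, hpi.map_eq, hset]
  exact (hL.restrict_image_emb (MeasurableEquiv.toLp 2 (d → ℝ)).measurableEmbedding _).map_eq

/-- **`reprSym` is measure preserving** from Haar measure on `T^d` to Lebesgue measure on the
cube `(-1/2, 1/2]^d` (the `MeasurePreserving` form of `map_reprSym_volume`; compare
`Torus.measurePreserving_repr` for `[0, 1)^d` in `FlatTorusProofs` and
`Torus.measurePreserving_reprc` for `[-1/2, 1/2)^d` in `TorusMollifier`). [folklore] -/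
theorem measurePreserving_reprSym :
    MeasurePreserving (reprSym : UnitAddTorus d → EuclideanSpace ℝ d) volume
      (volume.restrict (symCube d)) :=
  ⟨measurable_reprSym, map_reprSym_volume⟩

/-- A closed ball of radius `r < 1/2` about `0` in `ℝ^d` lies in the half-open symmetric cube
`(-1/2, 1/2]^d`. [folklore] -/
theorem closedBall_subset_symCube {r : ℝ} (hr : r < 1 / 2) :
    closedBall (0 : EuclideanSpace ℝ d) r ⊆ symCube d := by
  intro y hy i
  rw [mem_closedBall, dist_zero_right] at hy
  have h1 : |y i| ≤ ‖y‖ := by simpa using PiLp.norm_apply_le y i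
  rw [abs_le] at h1
  constructor <;> linarith [h1.1, h1.2]

/-- **Haar measure of minimal-image sets**: for measurable `B ⊆ ℝ^d`,
`vol {x ∈ T^d | reprSym (x - y) ∈ B} = vol (B ∩ (-1/2, 1/2]^d)`. [folklore] -/
theorem volume_reprSym_sub_mem (y : UnitAddTorus d) {B : Set (EuclideanSpace ℝ d)}
    (hB : MeasurableSet B) :
    volume {x : UnitAddTorus d | reprSym (x - y) ∈ B} = volume (B ∩ symCube d) := by
  have h1 : {x : UnitAddTorus d | reprSym (x - y) ∈ B} =
      (fun x => x - y) ⁻¹' (reprSym ⁻¹' B) := rfl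
  rw [h1, (measurePreserving_sub_right volume y).measure_preimage
    ((measurable_reprSym hB).nullMeasurableSet), ← Measure.map_apply measurable_reprSym hB,
    map_reprSym_volume, Measure.restrict_apply hB]

/-- The Haar measure of a minimal-image ball of radius `r < 1/2` is the Lebesgue measure of the
Euclidean ball. [folklore] -/
theorem volume_euclidDist_le {r : ℝ} (hr : r < 1 / 2) (y : UnitAddTorus d) :
    volume {x : UnitAddTorus d | euclidDist x y ≤ r} =
      volume (closedBall (0 : EuclideanSpace ℝ d) r) := by
  have h := volume_reprSym_sub_mem y (measurableSet_closedBall (x := (0 : EuclideanSpace ℝ d))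
    (ε := r))
  rw [inter_eq_left.2 (closedBall_subset_symCube hr)] at h
  rw [← h]
  congr 1
  ext x
  simp [euclidDist, mem_closedBall, dist_zero_right]

/-- The Haar measure of an open minimal-image ball of radius `r < 1/2`. [folklore] -/
theorem volume_euclidDist_lt {r : ℝ} (hr : r < 1 / 2) (y : UnitAddTorus d) :
    volume {x : UnitAddTorus d | euclidDist x y < r} =
      volume (ball (0 : EuclideanSpace ℝ d) r) := by
  have h := volume_reprSym_sub_mem y (measurableSet_ball (x := (0 : EuclideanSpace ℝ d)) (ε := r))
  rw [inter_eq_left.2 (ball_subset_closedBall.trans (closedBall_subset_symCube hr))] at h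
  rw [← h]
  congr 1
  ext x
  simp [euclidDist, mem_ball, dist_zero_right]

/-- **Contact spheres are Haar-null**: `vol {x ∈ T^d | dist(x, y) = r} = 0` for `r ≠ 0`. [folklore] -/
theorem volume_euclidDist_eq {r : ℝ} (hr : r ≠ 0) (y : UnitAddTorus d) :
    volume {x : UnitAddTorus d | euclidDist x y = r} = 0 := by
  have h := volume_reprSym_sub_mem y (isClosed_sphere (x := (0 : EuclideanSpace ℝ d))
    (ε := r)).measurableSet
  have h0 : volume (sphere (0 : EuclideanSpace ℝ d) r ∩ symCube d) = 0 :=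
    measure_mono_null inter_subset_left (Measure.addHaar_sphere_of_ne_zero _ _ hr)
  rw [h0] at h
  rw [← h]
  congr 1
  ext x
  simp [euclidDist]

/-- Elementary: `(ε + η)^n - ε^n ≤ n η` for `0 ≤ ε`, `0 ≤ η`, `ε + η ≤ 1`. [folklore] -/
theorem pow_add_sub_pow_le {ε η : ℝ} (hε : 0 ≤ ε) (hη : 0 ≤ η) (h1 : ε + η ≤ 1) (n : ℕ) :
    (ε + η) ^ n - ε ^ n ≤ n * η := by
  have key := geom_sum₂_mul (ε + η) ε n
  have hsum : (∑ i ∈ Finset.range n, (ε + η) ^ i * ε ^ (n - 1 - i)) ≤ n := by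
    calc (∑ i ∈ Finset.range n, (ε + η) ^ i * ε ^ (n - 1 - i))
        ≤ ∑ _i ∈ Finset.range n, (1 : ℝ) := by
          refine Finset.sum_le_sum fun i _ => ?_
          calc (ε + η) ^ i * ε ^ (n - 1 - i) ≤ 1 ^ i * 1 ^ (n - 1 - i) := by
                gcongr
                · linarith
            _ = 1 := by simp
      _ = n := by simp
  have hpos : 0 ≤ ∑ i ∈ Finset.range n, (ε + η) ^ i * ε ^ (n - 1 - i) :=
    Finset.sum_nonneg fun i _ => by positivity
  nlinarith [key, hsum, hpos]

/-- **The Haar measure of a minimal-image annulus**: for `0 < ε`, `0 ≤ η` with `ε + η < 1/2`,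
`vol {x | ε ≤ dist(x, y) ≤ ε + η} ≤ d η · vol(B₁)`. [folklore] -/
theorem volume_annulus_le {ε η : ℝ} (hε : 0 < ε) (hη : 0 ≤ η) (h : ε + η < 1 / 2)
    (y : UnitAddTorus d) :
    volume {x : UnitAddTorus d | ε ≤ euclidDist x y ∧ euclidDist x y ≤ ε + η} ≤
      ENNReal.ofReal (Fintype.card d * η) * volume (ball (0 : EuclideanSpace ℝ d) 1) := by
  have hsub : {x : UnitAddTorus d | ε ≤ euclidDist x y ∧ euclidDist x y ≤ ε + η} =
      {x | euclidDist x y ≤ ε + η} \ {x | euclidDist x y < ε} := by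
    ext x; simp [not_lt, and_comm]
  rw [hsub]
  have hcont : Continuous fun x : UnitAddTorus d => euclidDist x y := by
    have h1 := (continuous_norm_reprSym (d := d)).comp (continuous_sub_right y)
    simpa only [Function.comp_def, euclidDist] using h1
  have hs : MeasurableSet {x : UnitAddTorus d | euclidDist x y < ε} :=
    measurableSet_lt hcont.measurable measurable_const
  refine (measure_sdiff_le_iff_le_add hs.nullMeasurableSet (fun x hx => ?_)
    (measure_ne_top _ _)).2 ?_
  · simp only [mem_setOf_eq] at hx ⊢
    linarith
  have hfin : (Module.finrank ℝ (EuclideanSpace ℝ d) : ℝ) = Fintype.card d := by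
    rw [finrank_euclideanSpace]
  have key := pow_add_sub_pow_le hε.le hη (by linarith) (Module.finrank ℝ (EuclideanSpace ℝ d))
  rw [hfin] at key
  rw [volume_euclidDist_le h, volume_euclidDist_lt (by linarith) y,
    Measure.addHaar_closedBall _ _ (by linarith), Measure.addHaar_ball_of_pos _ _ hε, ← add_mul]
  gcongr
  rw [← ENNReal.ofReal_add (by positivity) (by positivity)]
  exact ENNReal.ofReal_le_ofReal (by linarith)


/-- **`proj` pushes Lebesgue measure on the cube `(-1/2, 1/2]^d` to Haar measure on `T^d`**
(the cube is a measurable fundamental domain with section `reprSym`). [folklore] -/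
theorem map_proj_volume_restrict_symCube :
    Measure.map (FunctionSpaces.Torus.proj : EuclideanSpace ℝ d → UnitAddTorus d) (volume.restrict (symCube d)) =
      (volume : Measure (UnitAddTorus d)) := by
  rw [← map_reprSym_volume, Measure.map_map FunctionSpaces.Torus.measurable_proj measurable_reprSym]
  have : (FunctionSpaces.Torus.proj ∘ reprSym : UnitAddTorus d → UnitAddTorus d) = id := funext proj_reprSym
  rw [this, Measure.map_id]

end Torus

/-! ## Fubini on the torus phase space, one particle at a time -/

section Kinetic

open Torus FunctionSpaces.Torus

variable {d : Type*} [Fintype d] {N : ℕ}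

/-- The velocity ball `{z | ∀ i, ‖v_i‖ ≤ V}` of the `N`-particle phase space (it contains the
energy shell `E(z) ≤ V²/2`, `norm_vel_le_of_configEnergy_le`). [folklore] -/
def velBall (N : ℕ) (d : Type*) [Fintype d] (X : Type*) (V : ℝ) : Set (Config N d X) :=
  {z | ∀ i, ‖(z i).2‖ ≤ V}

/-- The velocity ball is a box. [folklore] -/
theorem velBall_eq_pi {X : Type*} (V : ℝ) :
    velBall N d X V = Set.pi univ fun _ : Fin N =>
      (univ : Set X) ×ˢ Metric.closedBall (0 : EuclideanSpace ℝ d) V := by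
  ext z
  simp [velBall]

/-- The velocity ball is measurable. [folklore] -/
theorem measurableSet_velBall {X : Type*} [MeasurableSpace X] (V : ℝ) :
    MeasurableSet (velBall N d X V) := by
  rw [velBall_eq_pi]
  exact MeasurableSet.univ_pi fun _ => MeasurableSet.univ.prod Metric.isClosed_closedBall.measurableSet

/-- The energy shell `E(z) ≤ V²/2` lies in the velocity ball of radius `V`. [folklore] -/
theorem setOf_configEnergy_le_subset_velBall {X : Type*} {V : ℝ} (hV : 0 ≤ V) :
    {z : Config N d X | configEnergy z ≤ V ^ 2 / 2} ⊆ velBall N d X V :=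
  fun _ hz i => norm_vel_le_of_configEnergy_le hV hz i

/-- Every configuration lies in the velocity ball of some natural radius. [folklore] -/
theorem exists_mem_velBall_nat {X : Type*} (z : Config N d X) : ∃ n : ℕ, z ∈ velBall N d X n := by
  obtain ⟨n, hn⟩ := exists_nat_ge (∑ i, ‖(z i).2‖)
  refine ⟨n, fun i => le_trans ?_ hn⟩
  exact Finset.single_le_sum (f := fun i => ‖(z i).2‖) (fun _ _ => norm_nonneg _)
    (Finset.mem_univ i)

/-- The one-particle reference measure with velocities cut off at speed `V`:
Haar on `T^d` times Lebesgue on the closed ball of radius `V` of `ℝ^d` (a finite measure). [folklore] -/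
def oneParticleMeasure (d : Type*) [Fintype d] (V : ℝ) :
    Measure (UnitAddTorus d × EuclideanSpace ℝ d) :=
  (volume : Measure (UnitAddTorus d)).prod
    ((volume : Measure (EuclideanSpace ℝ d)).restrict (Metric.closedBall 0 V))

/-- The one-particle cut-off measure is σ-finite (indeed finite). [folklore] -/
instance oneParticleMeasure.instSigmaFinite (V : ℝ) : SigmaFinite (oneParticleMeasure d V) := by
  unfold oneParticleMeasure; infer_instance

/-- The one-particle cut-off measure is the restriction of `volume` to `T^d × B̄(0, V)`. [folklore] -/
theorem oneParticleMeasure_eq_restrict (V : ℝ) :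
    oneParticleMeasure d V =
      (volume : Measure (UnitAddTorus d × EuclideanSpace ℝ d)).restrict
        ((univ : Set (UnitAddTorus d)) ×ˢ Metric.closedBall (0 : EuclideanSpace ℝ d) V) := by
  rw [oneParticleMeasure, Measure.volume_eq_prod, ← Measure.prod_restrict, Measure.restrict_univ]

/-- The one-particle cut-off measure is dominated by `volume`. [folklore] -/
theorem oneParticleMeasure_le_volume (V : ℝ) :
    oneParticleMeasure d V ≤ (volume : Measure (UnitAddTorus d × EuclideanSpace ℝ d)) := by
  rw [oneParticleMeasure_eq_restrict]
  exact Measure.restrict_le_self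

/-- The one-particle cut-off measure of a position event `A × ℝ^d` is `vol(A) · mass`. [folklore] -/
theorem oneParticleMeasure_prod_univ (V : ℝ) (A : Set (UnitAddTorus d)) :
    oneParticleMeasure d V (A ×ˢ (univ : Set (EuclideanSpace ℝ d))) =
      volume A * oneParticleMeasure d V univ := by
  rw [oneParticleMeasure, ← univ_prod_univ, Measure.prod_prod, Measure.prod_prod]
  have : (volume : Measure (UnitAddTorus d)) univ = 1 := measure_univ
  rw [this, one_mul]

/-- **Volume with velocity cut-off is a product**: `volume` on `(T^d × ℝ^d)^N` restricted to
`velBall V` is the `N`-fold product of the one-particle cut-off measures. [folklore] -/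
theorem pi_oneParticleMeasure (V : ℝ) :
    Measure.pi (fun _ : Fin N => oneParticleMeasure d V) =
      (volume : Measure (Config N d (UnitAddTorus d))).restrict (velBall N d (UnitAddTorus d) V) := by
  rw [velBall_eq_pi, volume_pi, Measure.restrict_pi_pi]
  congr 1
  funext i
  rw [oneParticleMeasure_eq_restrict]

/-- The volume of the velocity ball: `vol(B̄(0,V))^N` (Haar on `T^d` is a probability measure). [folklore] -/
theorem volume_velBall (V : ℝ) :
    volume (velBall N d (UnitAddTorus d) V) =
      (volume (Metric.closedBall (0 : EuclideanSpace ℝ d) V)) ^ N := by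
  rw [← Measure.restrict_apply_univ, ← pi_oneParticleMeasure, Measure.pi_univ]
  simp [oneParticleMeasure, ← univ_prod_univ, Measure.prod_prod]

/-- **Fubini, one particle at a time (comparison form).** Let `S ⊆ S'` be measurable sets of
configurations, `S'` not depending on the coordinates of particle `a`, and suppose every
`a`-section of `S` through a point of `S'` has one-particle cut-off measure at most `c · mass`. Then
`vol(S ∩ velBall V) ≤ c · vol(S' ∩ velBall V)` (Tonelli over the coordinates of particle `a`;
the mechanism of GST 2013 Lemma 4.1.2). [cite: GST2013, Lemma 4.1.2] -/
theorem volume_inter_velBall_le_of_sections {V : ℝ} {S S' : Set (Config N d (UnitAddTorus d))}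
    (hS : MeasurableSet S) (hS' : MeasurableSet S') (a : Fin N) (c : ℝ≥0∞) (hsub : S ⊆ S')
    (hinv : ∀ z y, z ∈ S' → update z a y ∈ S')
    (hsec : ∀ z ∈ S', oneParticleMeasure d V {y | update z a y ∈ S} ≤
      c * oneParticleMeasure d V univ) :
    volume (S ∩ velBall N d (UnitAddTorus d) V) ≤
      c * volume (S' ∩ velBall N d (UnitAddTorus d) V) := by
  set ν : Fin N → Measure (UnitAddTorus d × EuclideanSpace ℝ d) := fun _ => oneParticleMeasure d V
    with hν
  rw [← Measure.restrict_apply hS, ← Measure.restrict_apply hS', ← pi_oneParticleMeasure,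
    ← lintegral_indicator_one hS, ← lintegral_indicator_one hS', ← lintegral_const_mul _
      (measurable_one.indicator hS')]
  refine lintegral_le_of_lmarginal_le {a} (measurable_one.indicator hS)
    ((measurable_one.indicator hS').const_mul c) fun x => ?_
  rw [lmarginal_singleton, lmarginal_singleton]
  dsimp only
  have h1 : ∀ y, S.indicator (1 : Config N d (UnitAddTorus d) → ℝ≥0∞) (update x a y) =
      {y | update x a y ∈ S}.indicator 1 y := by
    intro y; simp only [indicator, mem_setOf_eq]; rfl
  have hinv' : ∀ y, (update x a y ∈ S' ↔ x ∈ S') := by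
    intro y
    refine ⟨fun h => ?_, fun h => hinv x y h⟩
    have := hinv _ (x a) h
    rwa [update_idem, update_eq_self] at this
  have h2 : ∀ y, c * S'.indicator (1 : Config N d (UnitAddTorus d) → ℝ≥0∞) (update x a y) =
      c * S'.indicator 1 x := by
    intro y
    by_cases hx : x ∈ S'
    · rw [indicator_of_mem hx, indicator_of_mem ((hinv' y).2 hx)]; rfl
    · rw [indicator_of_notMem hx, indicator_of_notMem (mt (hinv' y).1 hx)]
  have hmeas : MeasurableSet {y | update x a y ∈ S} := hS.preimage (measurable_update x)
  simp_rw [h1, h2, lintegral_indicator_one hmeas, lintegral_const]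
  by_cases hx : x ∈ S'
  · simpa [hx] using hsec x hx
  · have : {y | update x a y ∈ S} = ∅ := by
      ext y
      simp only [mem_setOf_eq, mem_empty_iff_false, iff_false]
      exact fun h => hx ((hinv' y).1 (hsub h))
    simp [this]

/-- **Fubini, one particle at a time (null form).** A measurable set of configurations all of
whose sections in the coordinates of one particle are `vol`-null is `vol`-null. [folklore] -/
theorem volume_eq_zero_of_sections {S : Set (Config N d (UnitAddTorus d))} (hS : MeasurableSet S)
    (a : Fin N)
    (hsec : ∀ z, volume {y : UnitAddTorus d × EuclideanSpace ℝ d | update z a y ∈ S} = 0) :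
    volume S = 0 := by
  have hcov : S ⊆ ⋃ n : ℕ, S ∩ velBall N d (UnitAddTorus d) n := by
    intro z hz
    obtain ⟨n, hn⟩ := exists_mem_velBall_nat z
    exact mem_iUnion.2 ⟨n, hz, hn⟩
  refine measure_mono_null hcov (measure_iUnion_null fun n => ?_)
  have h := volume_inter_velBall_le_of_sections (V := n) hS MeasurableSet.univ a 0 (subset_univ S)
    (fun _ _ _ => mem_univ _) fun z _ => ?_
  · simpa using h
  · rw [zero_mul]
    exact (Measure.le_iff'.1 (oneParticleMeasure_le_volume (d := d) (n : ℝ)) _).trans_eq (hsec z)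

end Kinetic

/-! ## Null sets and thin sets of the torus phase space -/

section Kinetic

open Torus FunctionSpaces.Torus

variable {d : Type*} [Fintype d] {N : ℕ}

/-- **Contact configurations are Liouville-null**: `vol {z | ‖x_i - x_j‖_{T^d} = ε} = 0` for
`ε ≠ 0`, `i ≠ j` (a sphere condition on `x_i` for fixed `x_j`; GST 2013 §4.1: the boundary of
`D_ε^N` has measure zero). [cite: GST2013, §4.1] -/
theorem volume_setOf_norm_sepVec_eq {ε : ℝ} (hε : ε ≠ 0) {i j : Fin N} (hij : i ≠ j) :
    volume {z : Config N d (UnitAddTorus d) |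
      ‖(Torus.geometry d).sepVec (z i).1 (z j).1‖ = ε} = 0 := by
  have hmeas : MeasurableSet {z : Config N d (UnitAddTorus d) |
      ‖(Torus.geometry d).sepVec (z i).1 (z j).1‖ = ε} := by
    have hm : Measurable fun z : Config N d (UnitAddTorus d) =>
        (Torus.geometry d).sepVec (z i).1 (z j).1 :=
      Torus.measurable_geometry_sepVec.comp
        ((measurable_pi_apply i).fst.prodMk (measurable_pi_apply j).fst)
    exact measurableSet_eq_fun hm.norm measurable_const
  refine volume_eq_zero_of_sections hmeas i fun z => ?_
  have hsec : {y : UnitAddTorus d × EuclideanSpace ℝ d | update z i y ∈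
      {z : Config N d (UnitAddTorus d) | ‖(Torus.geometry d).sepVec (z i).1 (z j).1‖ = ε}} =
      {x : UnitAddTorus d | euclidDist x (z j).1 = ε} ×ˢ (univ : Set (EuclideanSpace ℝ d)) := by
    ext y
    simp only [mem_setOf_eq, update_self, update_of_ne hij.symm, Torus.geometry_sepVec, euclidDist,
      mem_prod, mem_univ, and_true]
  rw [hsec, Measure.volume_eq_prod, Measure.prod_prod, volume_euclidDist_eq hε, zero_mul]

/-- Contact sets of the torus are Liouville-null (`ε ≠ 0`, `i ≠ j`). [cite: GST2013, §4.1] -/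
theorem volume_contactSet {ε : ℝ} (hε : ε ≠ 0) {i j : Fin N} (hij : i ≠ j) :
    volume (contactSet (Torus.geometry d) N ε i j) = 0 :=
  measure_mono_null (fun _ hz => (mem_contactSet.1 hz).2) (volume_setOf_norm_sepVec_eq hε hij)

/-- The pair `(i, j)` is `r`-close to contact: `ε ≤ ‖x_i - x_j‖_{T^d} ≤ ε + r` (the thin shells
of GST 2013 Lemma 4.1.2). [cite: GST2013, Lemma 4.1.2] -/
def closePair (N : ℕ) (d : Type*) [Fintype d] (ε r : ℝ) (i j : Fin N) :
    Set (Config N d (UnitAddTorus d)) :=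
  {z | ε ≤ ‖(Torus.geometry d).sepVec (z i).1 (z j).1‖ ∧
    ‖(Torus.geometry d).sepVec (z i).1 (z j).1‖ ≤ ε + r}

/-- Membership in `closePair`. [folklore] -/
theorem mem_closePair {ε r : ℝ} {i j : Fin N} {z : Config N d (UnitAddTorus d)} :
    z ∈ closePair N d ε r i j ↔ ε ≤ ‖(Torus.geometry d).sepVec (z i).1 (z j).1‖ ∧
      ‖(Torus.geometry d).sepVec (z i).1 (z j).1‖ ≤ ε + r :=
  Iff.rfl

/-- `closePair` is measurable. [folklore] -/
theorem measurableSet_closePair (ε r : ℝ) (i j : Fin N) :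
    MeasurableSet (closePair N d ε r i j) := by
  have hm : Measurable fun z : Config N d (UnitAddTorus d) =>
      ‖(Torus.geometry d).sepVec (z i).1 (z j).1‖ :=
    (Torus.measurable_geometry_sepVec.comp
      ((measurable_pi_apply i).fst.prodMk (measurable_pi_apply j).fst)).norm
  exact (measurableSet_le measurable_const hm).inter (measurableSet_le hm measurable_const)

/-- `closePair` is symmetric in the pair. [folklore] -/
theorem closePair_comm (ε r : ℝ) (i j : Fin N) :
    closePair N d ε r i j = closePair N d ε r j i := by
  ext z
  simp only [mem_closePair, Torus.norm_geometry_sepVec, euclidDist_comm (z i).1]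

/-- **One thin shell costs a factor `r`**: for a measurable event `S'` not involving particle
`i`, `vol(closePair i j ∩ S' ∩ velBall V) ≤ (d r · vol B₁) · vol(S' ∩ velBall V)`
(`0 < ε`, `0 ≤ r`, `ε + r < 1/2`; GST 2013 Lemma 4.1.2, one integration). [cite: GST2013, Lemma 4.1.2] -/
theorem volume_closePair_inter_le {ε r : ℝ} (hε : 0 < ε) (hr : 0 ≤ r) (h : ε + r < 1 / 2)
    {i j : Fin N} (hij : i ≠ j) {S' : Set (Config N d (UnitAddTorus d))} (hS' : MeasurableSet S')
    (hinv : ∀ z y, z ∈ S' → update z i y ∈ S') (V : ℝ) :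
    volume (closePair N d ε r i j ∩ S' ∩ velBall N d (UnitAddTorus d) V) ≤
      ENNReal.ofReal (Fintype.card d * r) * volume (Metric.ball (0 : EuclideanSpace ℝ d) 1) *
        volume (S' ∩ velBall N d (UnitAddTorus d) V) := by
  refine volume_inter_velBall_le_of_sections ((measurableSet_closePair ε r i j).inter hS') hS' i
    _ inter_subset_right hinv fun z _ => ?_
  have hsec : {y : UnitAddTorus d × EuclideanSpace ℝ d | update z i y ∈ closePair N d ε r i j ∩ S'} ⊆
      {x : UnitAddTorus d | ε ≤ euclidDist x (z j).1 ∧ euclidDist x (z j).1 ≤ ε + r} ×ˢ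
        (univ : Set (EuclideanSpace ℝ d)) := by
    intro y hy
    have h1 := (mem_closePair.1 hy.1)
    simp only [update_self, update_of_ne hij.symm, Torus.norm_geometry_sepVec] at h1
    exact ⟨h1, mem_univ _⟩
  calc oneParticleMeasure d V {y | update z i y ∈ closePair N d ε r i j ∩ S'}
      ≤ oneParticleMeasure d V ({x : UnitAddTorus d | ε ≤ euclidDist x (z j).1 ∧
          euclidDist x (z j).1 ≤ ε + r} ×ˢ (univ : Set (EuclideanSpace ℝ d))) :=
        measure_mono hsec
    _ = volume {x : UnitAddTorus d | ε ≤ euclidDist x (z j).1 ∧ euclidDist x (z j).1 ≤ ε + r} *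
          oneParticleMeasure d V univ := oneParticleMeasure_prod_univ V _
    _ ≤ _ := by gcongr; exact Torus.volume_annulus_le hε hr h (z j).1

/-- Two distinct unordered pairs have a vertex of the first outside the second. [folklore] -/
theorem exists_mem_not_mem_of_pair_ne {i j k l : Fin N} (hij : i ≠ j)
    (hne : ({i, j} : Finset (Fin N)) ≠ {k, l}) :
    ∃ a b : Fin N, ({a, b} : Finset (Fin N)) = {i, j} ∧ a ≠ k ∧ a ≠ l := by
  by_cases hi : i = k ∨ i = l
  · by_cases hj : j = k ∨ j = l
    · exfalso
      apply hne
      rcases hi with rfl | rfl <;> rcases hj with rfl | rfl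
      · exact absurd rfl hij
      · rfl
      · exact Finset.pair_comm _ _
      · exact absurd rfl hij
    · push Not at hj
      exact ⟨j, i, Finset.pair_comm _ _, hj.1, hj.2⟩
  · push Not at hi
    exact ⟨i, j, rfl, hi.1, hi.2⟩

/-- `closePair` only depends on the unordered pair. [folklore] -/
theorem closePair_eq_of_pair_eq {ε r : ℝ} {a b i j : Fin N} (hab : a ≠ b)
    (h : ({a, b} : Finset (Fin N)) = {i, j}) :
    closePair N d ε r a b = closePair N d ε r i j := by
  have ha : a ∈ ({i, j} : Finset (Fin N)) := h ▸ Finset.mem_insert_self a {b}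
  have hb : b ∈ ({i, j} : Finset (Fin N)) := h ▸ Finset.mem_insert_of_mem (Finset.mem_singleton_self b)
  simp only [Finset.mem_insert, Finset.mem_singleton] at ha hb
  rcases ha with rfl | rfl <;> rcases hb with rfl | rfl
  · exact absurd rfl hab
  · rfl
  · exact closePair_comm _ _ _ _
  · exact absurd rfl hab

/-- **Two thin shells cost `r²`** (GST 2013 Lemma 4.1.2, `|I| ≤ C ρ^{d(N-2)} δ²` in their
normalisation): for two distinct unordered pairs `{i, j} ≠ {k, l}`, the configurations in the
velocity ball of radius `V` in which both pairs are `r`-close to contact have volume at most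
`(d r · vol B₁)² · vol(B̄_V)^N` (`0 < ε`, `0 ≤ r`, `ε + r < 1/2`). [cite: GST2013, Lemma 4.1.2] -/
theorem volume_closePair_inter_closePair_le {ε r : ℝ} (hε : 0 < ε) (hr : 0 ≤ r)
    (h : ε + r < 1 / 2) {i j k l : Fin N} (hij : i ≠ j) (hkl : k ≠ l)
    (hne : ({i, j} : Finset (Fin N)) ≠ {k, l}) (V : ℝ) :
    volume (closePair N d ε r i j ∩ closePair N d ε r k l ∩ velBall N d (UnitAddTorus d) V) ≤
      (ENNReal.ofReal (Fintype.card d * r) * volume (Metric.ball (0 : EuclideanSpace ℝ d) 1)) ^ 2 *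
        volume (Metric.closedBall (0 : EuclideanSpace ℝ d) V) ^ N := by
  obtain ⟨a, b, hab, hak, hal⟩ := exists_mem_not_mem_of_pair_ne hij hne
  have hab' : a ≠ b := by
    rintro rfl
    have : ({i, j} : Finset (Fin N)).card ≤ 1 := by rw [← hab]; simp
    rw [Finset.card_pair hij] at this
    omega
  rw [← closePair_eq_of_pair_eq (d := d) (ε := ε) (r := r) hab' hab]
  have hinv1 : ∀ (z : Config N d (UnitAddTorus d)) y, z ∈ closePair N d ε r k l →
      update z a y ∈ closePair N d ε r k l := by
    intro z y hz
    simpa only [mem_closePair, update_of_ne hak.symm, update_of_ne hal.symm] using hz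
  have h1 := volume_closePair_inter_le hε hr h hab' (measurableSet_closePair ε r k l) hinv1 V
  have h2 := volume_closePair_inter_le (d := d) hε hr h hkl MeasurableSet.univ
    (fun _ _ _ => mem_univ _) V (S' := univ)
  rw [inter_univ, univ_inter, volume_velBall] at h2
  calc _ ≤ _ := h1
    _ ≤ ENNReal.ofReal (Fintype.card d * r) * volume (Metric.ball (0 : EuclideanSpace ℝ d) 1) *
        (ENNReal.ofReal (Fintype.card d * r) * volume (Metric.ball (0 : EuclideanSpace ℝ d) 1) *
          volume (Metric.closedBall (0 : EuclideanSpace ℝ d) V) ^ N) := by gcongr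
    _ = _ := by ring

/-! ### Grazing configurations are null -/

/-- **Lines see a null set in a null set of parameters ⇒ the set is null**: a measurable subset
of `ℝ^d` all of whose sections along the lines `s ↦ u + s e` (fixed direction `e`) are
Lebesgue-null is Lebesgue-null (Tonelli and translation invariance). [folklore] -/
theorem volume_eq_zero_of_line_sections {Z : Set (EuclideanSpace ℝ d)} (hZ : MeasurableSet Z)
    (e : EuclideanSpace ℝ d) (h : ∀ u, volume {s : ℝ | u + s • e ∈ Z} = 0) : volume Z = 0 := by
  have hcont : Continuous fun p : EuclideanSpace ℝ d × ℝ => p.1 + p.2 • e := by fun_prop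
  have hmeas : Measurable fun p : EuclideanSpace ℝ d × ℝ => Z.indicator (1 : EuclideanSpace ℝ d → ℝ≥0∞) (p.1 + p.2 • e) :=
    (measurable_one.indicator hZ).comp hcont.measurable
  -- `vol Z = ∫_{s ∈ [0,1]} vol ((· + s e)⁻¹ Z) ds = ∫_u ∫_{s ∈ [0,1]} 1_Z (u + s e) ds du ≤ ∫_u 0 = 0`
  have h1 : ∀ s : ℝ, volume Z = ∫⁻ u, Z.indicator (1 : EuclideanSpace ℝ d → ℝ≥0∞) (u + s • e) ∂volume := by
    intro s
    rw [← measure_preimage_add_right volume (s • e) Z, ← lintegral_indicator_one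
      (hZ.preimage (measurable_add_const _))]
    rfl
  have h2 : volume Z * volume (Icc (0 : ℝ) 1) =
      ∫⁻ s in Icc (0 : ℝ) 1, ∫⁻ u, Z.indicator (1 : EuclideanSpace ℝ d → ℝ≥0∞) (u + s • e) ∂volume ∂volume := by
    rw [← setLIntegral_const]
    exact setLIntegral_congr_fun measurableSet_Icc fun s _ => h1 s
  rw [Real.volume_Icc, sub_zero, ENNReal.ofReal_one, mul_one] at h2
  have hsw : AEMeasurable (uncurry fun (s : ℝ) (u : EuclideanSpace ℝ d) =>
      Z.indicator (1 : EuclideanSpace ℝ d → ℝ≥0∞) (u + s • e))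
      (((volume : Measure ℝ).restrict (Icc 0 1)).prod volume) :=
    (hmeas.comp measurable_swap).aemeasurable
  rw [h2, lintegral_lintegral_swap hsw]
  refine le_antisymm (le_trans (lintegral_mono fun u => ?_) (le_of_eq lintegral_zero)) bot_le
  have hZu : MeasurableSet {s : ℝ | u + s • e ∈ Z} :=
    hZ.preimage (hcont.measurable.comp (measurable_const.prodMk measurable_id))
  have hind : ∀ s : ℝ, Z.indicator (1 : EuclideanSpace ℝ d → ℝ≥0∞) (u + s • e) =
      {s : ℝ | u + s • e ∈ Z}.indicator (1 : ℝ → ℝ≥0∞) s := fun s => by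
    by_cases hs : u + s • e ∈ Z
    · rw [indicator_of_mem hs, indicator_of_mem (show s ∈ {s : ℝ | u + s • e ∈ Z} from hs)]
      rfl
    · rw [indicator_of_notMem hs, indicator_of_notMem (show s ∉ {s : ℝ | u + s • e ∈ Z} from hs)]
  calc ∫⁻ s in Icc (0 : ℝ) 1, Z.indicator (1 : EuclideanSpace ℝ d → ℝ≥0∞) (u + s • e) ∂volume
      ≤ ∫⁻ s, Z.indicator (1 : EuclideanSpace ℝ d → ℝ≥0∞) (u + s • e) ∂volume :=
        setLIntegral_le_lintegral _ _
    _ = volume {s : ℝ | u + s • e ∈ Z} := by simp_rw [hind, lintegral_indicator_one hZu]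
    _ = 0 := h u

/-- The zero set of a genuine real quadratic is Lebesgue-null (it has at most two points). [folklore] -/
theorem volume_setOf_quadratic_eq_zero {a b c : ℝ} (ha : a ≠ 0) :
    volume {s : ℝ | a * (s * s) + b * s + c = 0} = 0 := by
  by_cases hD : 0 ≤ discrim a b c
  · have hs : discrim a b c = Real.sqrt (discrim a b c) * Real.sqrt (discrim a b c) :=
      (Real.mul_self_sqrt hD).symm
    have hsub : {s : ℝ | a * (s * s) + b * s + c = 0} ⊆
        {(-b + Real.sqrt (discrim a b c)) / (2 * a), (-b - Real.sqrt (discrim a b c)) / (2 * a)} := by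
      intro s hs'
      rcases (quadratic_eq_zero_iff ha hs s).1 hs' with h | h
      · exact Or.inl h
      · exact Or.inr h
    exact measure_mono_null hsub ((Set.toFinite _).measure_zero _)
  · have : {s : ℝ | a * (s * s) + b * s + c = 0} = ∅ := by
      ext s
      simp only [mem_setOf_eq, mem_empty_iff_false, iff_false]
      refine quadratic_ne_zero_of_discrim_ne_sq (fun t ht => hD ?_) s
      rw [ht]; exact sq_nonneg t
    rw [this, measure_empty]

/-- **The grazing variety is null in the position variable**: for `ε ≠ 0` and a relative
velocity `w ≠ 0`, the separations `n ∈ ℝ^d` with vanishing discriminant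
`pairDisc ε n w = ⟪n, w⟫² - ‖w‖² (‖n‖² - ε²) = 0` (the line `n + t w` is tangent to the sphere of
radius `ε`: a cylinder of radius `ε` around `ℝ w`) form a Lebesgue-null set. [folklore] -/
theorem volume_setOf_pairDisc_eq_zero {ε : ℝ} (hε : ε ≠ 0) {w : EuclideanSpace ℝ d} (hw : w ≠ 0) :
    volume {n : EuclideanSpace ℝ d | pairDisc ε n w = 0} = 0 := by
  have hmeas : MeasurableSet {n : EuclideanSpace ℝ d | pairDisc ε n w = 0} := by
    have : Continuous fun n : EuclideanSpace ℝ d => pairDisc ε n w := by unfold pairDisc; fun_prop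
    exact measurableSet_eq_fun this.measurable measurable_const
  by_cases hK : (ℝ ∙ w)ᗮ = ⊥
  · -- one-dimensional case: every `n` is a multiple of `w`, and then `pairDisc = ε² ‖w‖² ≠ 0`
    rw [Submodule.orthogonal_eq_bot_iff] at hK
    have : {n : EuclideanSpace ℝ d | pairDisc ε n w = 0} = ∅ := by
      ext n
      simp only [mem_setOf_eq, mem_empty_iff_false, iff_false]
      have hn : n ∈ (ℝ ∙ w) := hK ▸ Submodule.mem_top
      obtain ⟨t, rfl⟩ := Submodule.mem_span_singleton.1 hn
      intro h
      simp only [pairDisc, real_inner_smul_left, real_inner_self_eq_norm_sq, norm_smul, mul_pow,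
        Real.norm_eq_abs, sq_abs] at h
      have hw' : 0 < ‖w‖ ^ 2 := by positivity
      have hε' : 0 < ε ^ 2 := by positivity
      have : ‖w‖ ^ 2 * ε ^ 2 = 0 := by linear_combination h
      exact (mul_pos hw' hε').ne' this
    rw [this, measure_empty]
  · obtain ⟨e, he, he0⟩ := (Submodule.ne_bot_iff _).1 hK
    rw [Submodule.mem_orthogonal_singleton_iff_inner_right] at he
    refine volume_eq_zero_of_line_sections hmeas e fun u => ?_
    have hlead : -(‖w‖ ^ 2 * ‖e‖ ^ 2) ≠ 0 := by
      have : 0 < ‖w‖ ^ 2 * ‖e‖ ^ 2 := by positivity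
      linarith
    refine measure_mono_null (fun s hs => ?_) (volume_setOf_quadratic_eq_zero hlead
      (b := -(2 * ‖w‖ ^ 2 * ⟪u, e⟫_ℝ)) (c := ⟪u, w⟫_ℝ ^ 2 - ‖w‖ ^ 2 * (‖u‖ ^ 2 - ε ^ 2)))
    simp only [mem_setOf_eq, pairDisc] at hs ⊢
    rw [inner_add_left, real_inner_smul_left, real_inner_comm w e, he, mul_zero, add_zero,
      norm_add_sq_real, real_inner_smul_right, norm_smul, mul_pow, Real.norm_eq_abs, sq_abs] at hs
    linear_combination hs

/-- **Grazing configurations are Liouville-null**: for `ε ≠ 0` and `i ≠ j`, the configurations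
whose pair `(i, j)` has nonzero relative velocity and vanishing discriminant (its free relative
motion in the minimal-image chart is tangent to the contact sphere) form a null set (GST 2013
§4.1: grazing collisions are pathological and negligible). [cite: GST2013, §4.1 p. 19] -/
theorem volume_setOf_pairDisc_sepVec_eq_zero {ε : ℝ} (hε : ε ≠ 0) {i j : Fin N} (hij : i ≠ j) :
    volume {z : Config N d (UnitAddTorus d) |
      pairDisc ε ((Torus.geometry d).sepVec (z i).1 (z j).1) ((z i).2 - (z j).2) = 0 ∧
        (z i).2 ≠ (z j).2} = 0 := by
  have hdisc : Measurable fun p : EuclideanSpace ℝ d × EuclideanSpace ℝ d => pairDisc ε p.1 p.2 := by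
    have : Continuous fun p : EuclideanSpace ℝ d × EuclideanSpace ℝ d => pairDisc ε p.1 p.2 := by
      unfold pairDisc; fun_prop
    exact this.measurable
  have hmeas : MeasurableSet {z : Config N d (UnitAddTorus d) |
      pairDisc ε ((Torus.geometry d).sepVec (z i).1 (z j).1) ((z i).2 - (z j).2) = 0 ∧
        (z i).2 ≠ (z j).2} := by
    have hm1 : Measurable fun z : Config N d (UnitAddTorus d) =>
        (Torus.geometry d).sepVec (z i).1 (z j).1 :=
      Torus.measurable_geometry_sepVec.comp
        ((measurable_pi_apply i).fst.prodMk (measurable_pi_apply j).fst)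
    have hm2 : Measurable fun z : Config N d (UnitAddTorus d) => (z i).2 - (z j).2 :=
      (measurable_pi_apply i).snd.sub (measurable_pi_apply j).snd
    exact (measurableSet_eq_fun (hdisc.comp (hm1.prodMk hm2)) measurable_const).inter
      (measurableSet_eq_fun (measurable_pi_apply i).snd (measurable_pi_apply j).snd).compl
  refine volume_eq_zero_of_sections hmeas i fun z => ?_
  have hT' : {y : UnitAddTorus d × EuclideanSpace ℝ d | update z i y ∈
      {z : Config N d (UnitAddTorus d) |
        pairDisc ε ((Torus.geometry d).sepVec (z i).1 (z j).1) ((z i).2 - (z j).2) = 0 ∧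
          (z i).2 ≠ (z j).2}} = {y : UnitAddTorus d × EuclideanSpace ℝ d |
      pairDisc ε (reprSym (y.1 - (z j).1)) (y.2 - (z j).2) = 0 ∧ y.2 ≠ (z j).2} := by
    ext y
    simp only [mem_setOf_eq, update_self, update_of_ne hij.symm, Torus.geometry_sepVec]
  have hTm : MeasurableSet {y : UnitAddTorus d × EuclideanSpace ℝ d |
      pairDisc ε (reprSym (y.1 - (z j).1)) (y.2 - (z j).2) = 0 ∧ y.2 ≠ (z j).2} :=
    (measurableSet_eq_fun (hdisc.comp ((measurable_reprSym.comp
      (measurable_fst.sub_const _)).prodMk (measurable_snd.sub_const _))) measurable_const).inter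
      (measurableSet_eq_fun measurable_snd measurable_const).compl
  rw [hT', Measure.volume_eq_prod, Measure.prod_apply_symm hTm]
  refine (lintegral_congr fun v => ?_).trans lintegral_zero
  change volume ((fun x : UnitAddTorus d => (x, v)) ⁻¹' _) = 0
  by_cases hv : v = (z j).2
  · have : (fun x : UnitAddTorus d => (x, v)) ⁻¹' {y : UnitAddTorus d × EuclideanSpace ℝ d |
        pairDisc ε (reprSym (y.1 - (z j).1)) (y.2 - (z j).2) = 0 ∧ y.2 ≠ (z j).2} = ∅ := by
      ext x
      simp only [mem_preimage, mem_setOf_eq, hv, ne_eq, not_true_eq_false, and_false,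
        mem_empty_iff_false]
    rw [this, measure_empty]
  · have hw : v - (z j).2 ≠ 0 := sub_ne_zero.2 hv
    have hset : (fun x : UnitAddTorus d => (x, v)) ⁻¹' {y : UnitAddTorus d × EuclideanSpace ℝ d |
        pairDisc ε (reprSym (y.1 - (z j).1)) (y.2 - (z j).2) = 0 ∧ y.2 ≠ (z j).2} =
        {x : UnitAddTorus d | reprSym (x - (z j).1) ∈
          {n : EuclideanSpace ℝ d | pairDisc ε n (v - (z j).2) = 0}} := by
      ext x
      simp only [mem_preimage, mem_setOf_eq, ne_eq, hv, not_false_eq_true, and_true]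
    have hZ : MeasurableSet {n : EuclideanSpace ℝ d | pairDisc ε n (v - (z j).2) = 0} := by
      have hc : Continuous fun n : EuclideanSpace ℝ d => pairDisc ε n (v - (z j).2) := by
        unfold pairDisc; fun_prop
      exact measurableSet_eq_fun hc.measurable measurable_const
    rw [hset]
    have hkey := volume_reprSym_sub_mem (d := d) (z j).1 hZ
    refine hkey.trans ?_
    exact measure_mono_null inter_subset_left (volume_setOf_pairDisc_eq_zero hε hw)

end Kinetic

end

end Literature.Analysis.FluidPDE
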